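import Summits.RiemannHypothesis.RiemannHypothesis.Theses.WeilComb
import Summits.RiemannHypothesis.RiemannHypothesis.Theorems.WeilCombCombShapePositivityStubWindowMellin
import Summits.RiemannHypothesis.RiemannHypothesis.Theorems.WeilCombCombShapePositivityStubWindowNorm
import Summits.RiemannHypothesis.RiemannHypothesis.Theorems.WeilCombCombShapePositivityExactPrimeWindow
import Summits.RiemannHypothesis.RiemannHypothesis.Theorems.WeilCombCombShapePositivityPolarExact
import Summits.RiemannHypothesis.RiemannHypothesis.Theorems.CombShapePositivity.Negative.WeilCombCombShapePositivityLoadBearing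
import Literature.NumberTheory.LFunctions.WeilExplicit
import Literature.NumberTheory.LFunctions.WeilExplicitProofs
import Literature.NumberTheory.LFunctions.WeilExplicitFormulaProofs
import Literature.NumberTheory.LFunctions.WeilArchimedeanPositivityProofs
import Literature.NumberTheory.LFunctions.WeilSmallSupportPositivity
import Literature.NumberTheory.LFunctions.UniformWeilPositivityRH

/-!
# `stub_windowCore` cells: the signed normal form IS `0 ≤ Re Q` on the window; cells from support rungs
(crux `WeilComb.CombShapePositivity`, item stmt-RiemannHypothesis-11229, line `Sketch`, stub `stub_windowCore`)

Notation. `φ₀(u) = expNegInvGlue (1 - u²)`, `φ_ε(t) = ε⁻¹ φ₀(t/ε)`, comb `g = Σ_{m ≤ M} a_m φ_ε(· − log m)`,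
`Q(g) = W(g ⋆ g̃)`, `N₀ = ‖φ₀‖₂²`, `U = ε⁻¹N₀`, `H(a) = 2 Re Σ_m Σ_{n ≤ M/m} Λ(n) n^{-1/2} a(nm) conj a(m)`,
`L = Σ ‖a_m‖²`, `A∓ = Σ a_m m^{∓1/2}`, `D_a(t) = Σ a_m m^{it}`, `ρ(t) = Re ψ(1/4 + it/2)`.

The registered stub `stub_windowCore` (skeleton v7, sha 86d35e56a923) is the signed normal form
  `U (H(a) + log π · L) ≤ 2 Re(φ̂_ε(0) conj φ̂_ε(1) · A₋ conj A₊) + (1/2π) ∫ |φ̂_ε(1/2+it)|² |D_a(t)|² ρ(t) dt`      (NF)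
on the band `1/40 < εM`, `2ε(M+1) ≤ 1`, `M ≥ 1`.  This file records, sorry-free:

* `windowCore_cell_iff` — on the whole exact window (`0 < ε`, `1 ≤ M`, `2ε(M+1) ≤ 1`) the cell (NF) at `(ε, M, a)` is
  EQUIVALENT to `0 ≤ Re Q(g)` (the identities p90904, p91841, p96387, p96510 and
  `weilArchIntegral_weilConv_weilReflect` are equalities; the skeleton uses only NF ⇒ `0 ≤ Re Q`);
* `windowCore_cell_of_weilPositivityOn` — a cell follows from the classical support rung
  `WeilPositivityOn (log M / 2 + ε)` (translation invariance of `Q`: the comb lives on `[−ε, log M + ε]`), so the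
  finite window range `M ≤ M₀` of Theorem B is exactly the rung `WeilPositivityOn (log M₀ / 2 + 1/(2(M₀+1)))`;
* `windowCore_cells_one` — the `M = 1` cells of the band hold unconditionally (`ε ≤ 1/4 < (log 2)/2`, Yoshida's
  archimedean rung `weilPositivityOn_of_le_log_two_half`, kernel-certified in the tree);
* `stub_windowCore_of_riemannHypothesis` — the stub, verbatim, under RH (calibration: the band statement is
  RH-implied, hence irrefutable at accessible heights).
-/

noncomputable section

-- the sub-problem path `RiemannHypothesis/RiemannHypothesis` (single-conjunct summit, D-0017) duplicates a namespace
set_option linter.dupNamespace false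

open scoped BigOperators ComplexConjugate
open Complex MeasureTheory

namespace Summit.RiemannHypothesis.RiemannHypothesis.Theorems.WeilCombBohrFejer

open Literature.NumberTheory.LFunctions

/-- **The real part of `Q(g)` in signed normal form (an identity on the exact window).** For `0 < ε`, `1 ≤ M`,
`2ε(M+1) ≤ 1`:
`Re Q(g) = 2 Re(φ̂_ε(0) conj φ̂_ε(1) A₋ conj A₊) − U·H(a) + ((1/2π)∫|φ̂_ε(1/2+it)|²|D_a(t)|²ρ(t)dt − U·L·log π)`.
[folklore] -/
theorem weilQuadratic_comb_re_normalForm : ∀ ε : ℝ, 0 < ε → ∀ (M : ℕ) (a : ℕ → ℂ), 1 ≤ M →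
    2 * ε * ((M : ℝ) + 1) ≤ 1 →
    (weilQuadratic (fun x : ℝ => ∑ m ∈ Finset.Icc 1 M,
        a m * ((ε : ℂ)⁻¹ * ((expNegInvGlue (1 - ((x - Real.log (m : ℝ)) / ε) ^ 2) : ℝ) : ℂ)))).re =
      2 * (weilMellin (fun t : ℝ => (ε : ℂ)⁻¹ * ((expNegInvGlue (1 - (t / ε) ^ 2) : ℝ) : ℂ)) 0 *
            conj (weilMellin (fun t : ℝ => (ε : ℂ)⁻¹ * ((expNegInvGlue (1 - (t / ε) ^ 2) : ℝ) : ℂ)) 1) *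
          ((∑ m ∈ Finset.Icc 1 M, a m * ((Real.sqrt (m : ℝ) : ℝ) : ℂ)⁻¹) *
            conj (∑ m ∈ Finset.Icc 1 M, a m * ((Real.sqrt (m : ℝ) : ℝ) : ℂ)))).re
      - ε⁻¹ * weilNorm2Sq (fun u : ℝ => ((expNegInvGlue (1 - u ^ 2) : ℝ) : ℂ)) *
          (2 * (∑ m ∈ Finset.Icc 1 M, ∑ n ∈ Finset.Icc 1 (M / m),
            ((ArithmeticFunction.vonMangoldt n : ℝ) : ℂ) / (Real.sqrt n : ℂ) * a (n * m) *
              conj (a m)).re)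
      + (1 / (2 * Real.pi) * (∫ t : ℝ,
          ‖weilMellin (fun t : ℝ => (ε : ℂ)⁻¹ * ((expNegInvGlue (1 - (t / ε) ^ 2) : ℝ) : ℂ))
              (1 / 2 + t * I)‖ ^ 2 *
            ‖∑ m ∈ Finset.Icc 1 M, a m * cexp (t * I * (Real.log (m : ℝ) : ℂ))‖ ^ 2 *
            (Complex.digamma (1 / 4 + t / 2 * I)).re)
        - ε⁻¹ * weilNorm2Sq (fun u : ℝ => ((expNegInvGlue (1 - u ^ 2) : ℝ) : ℂ)) *
            (∑ m ∈ Finset.Icc 1 M, ‖a m‖ ^ 2) * Real.log Real.pi) := by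
  intro ε hε M a hM hw
  set g : ℝ → ℂ := fun x : ℝ => ∑ m ∈ Finset.Icc 1 M,
      a m * ((ε : ℂ)⁻¹ * ((expNegInvGlue (1 - ((x - Real.log (m : ℝ)) / ε) ^ 2) : ℝ) : ℂ)) with hg
  set φε : ℝ → ℂ := fun t : ℝ => (ε : ℂ)⁻¹ * ((expNegInvGlue (1 - (t / ε) ^ 2) : ℝ) : ℂ) with hφε
  set N : ℝ := weilNorm2Sq (fun u : ℝ => ((expNegInvGlue (1 - u ^ 2) : ℝ) : ℂ)) with hN
  set L : ℝ := ∑ m ∈ Finset.Icc 1 M, ‖a m‖ ^ 2 with hL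
  set D : ℝ → ℂ := fun t : ℝ => ∑ m ∈ Finset.Icc 1 M, a m * cexp (t * I * (Real.log (m : ℝ) : ℂ)) with hD
  set J : ℝ := ∫ t : ℝ, ‖weilMellin φε (1 / 2 + t * I)‖ ^ 2 * ‖D t‖ ^ 2 *
      (Complex.digamma (1 / 4 + t / 2 * I)).re with hJ
  -- the comb is a Weil test
  have hgW : IsWeilTest g :=
    Summit.RiemannHypothesis.RiemannHypothesis.Theorems.weilComb_shapeComb_isWeilTest ε M a
  -- exact window identity and polar identity
  have h1 := weilQuadratic_comb_re_exactWindow ε hε M a hM hw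
  have h2 := weilPolarTerm_comb_re ε hε M a
  -- the archimedean term of `g ⋆ g̃`
  have h3 : (weilArchTerm (weilConv g (weilReflect g))).re =
      1 / (2 * Real.pi) * (∫ t : ℝ, ‖weilMellin g (1 / 2 + t * I)‖ ^ 2 *
        (Complex.digamma (1 / 4 + t / 2 * I)).re) - weilNorm2Sq g * Real.log Real.pi := by
    unfold weilArchTerm
    rw [weilArchIntegral_weilConv_weilReflect hgW, weilConv_weilReflect_apply_zero]
    have e : ((1 / (2 * Real.pi) : ℂ) * ((∫ t : ℝ, ‖weilMellin g (1 / 2 + t * I)‖ ^ 2 *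
          (Complex.digamma (1 / 4 + t / 2 * I)).re : ℝ) : ℂ) -
          ((∫ t : ℝ, ‖g t‖ ^ 2 : ℝ) : ℂ) * (Real.log Real.pi : ℂ)) =
        ((1 / (2 * Real.pi) * (∫ t : ℝ, ‖weilMellin g (1 / 2 + t * I)‖ ^ 2 *
          (Complex.digamma (1 / 4 + t / 2 * I)).re) - weilNorm2Sq g * Real.log Real.pi : ℝ) : ℂ) := by
      unfold weilNorm2Sq
      push_cast
      ring
    rw [e, Complex.ofReal_re]
  -- `|ĝ(1/2+it)|² = |φ̂_ε(1/2+it)|² |D_a(t)|²` under the integral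
  have h4 : (∫ t : ℝ, ‖weilMellin g (1 / 2 + t * I)‖ ^ 2 * (Complex.digamma (1 / 4 + t / 2 * I)).re) = J := by
    rw [hJ]
    congr 1
    funext t
    rw [hg, stub_windowMellin ε hε M a t, norm_mul, mul_pow]
    ring
  -- the window norm identity
  have h5 : weilNorm2Sq g = ε⁻¹ * N * L := by
    rw [hg, hN, hL]
    exact stub_windowNorm ε hε M a hw
  rw [h1, h2, h3, h4, h5]

/-- **A cell of `stub_windowCore` is exactly `0 ≤ Re Q(g)`.** For `0 < ε`, `1 ≤ M`, `2ε(M+1) ≤ 1` and every `a`, the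
signed-normal-form inequality (NF) at `(ε, M, a)` holds iff the fixed-shape comb has `0 ≤ Re W(g ⋆ g̃)`. [folklore] -/
theorem windowCore_cell_iff : ∀ ε : ℝ, 0 < ε → ∀ (M : ℕ) (a : ℕ → ℂ), 1 ≤ M →
    2 * ε * ((M : ℝ) + 1) ≤ 1 →
    ((ε⁻¹ * weilNorm2Sq (fun u : ℝ => ((expNegInvGlue (1 - u ^ 2) : ℝ) : ℂ)) *
        (2 * (∑ m ∈ Finset.Icc 1 M, ∑ n ∈ Finset.Icc 1 (M / m),
            ((ArithmeticFunction.vonMangoldt n : ℝ) : ℂ) / (Real.sqrt n : ℂ) * a (n * m) *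
              conj (a m)).re
          + Real.log Real.pi * ∑ m ∈ Finset.Icc 1 M, ‖a m‖ ^ 2) ≤
      2 * (weilMellin (fun t : ℝ => (ε : ℂ)⁻¹ * ((expNegInvGlue (1 - (t / ε) ^ 2) : ℝ) : ℂ)) 0 *
            conj (weilMellin (fun t : ℝ => (ε : ℂ)⁻¹ * ((expNegInvGlue (1 - (t / ε) ^ 2) : ℝ) : ℂ)) 1) *
          ((∑ m ∈ Finset.Icc 1 M, a m * ((Real.sqrt (m : ℝ) : ℝ) : ℂ)⁻¹) *
            conj (∑ m ∈ Finset.Icc 1 M, a m * ((Real.sqrt (m : ℝ) : ℝ) : ℂ)))).re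
      + 1 / (2 * Real.pi) * ∫ t : ℝ,
          ‖weilMellin (fun t : ℝ => (ε : ℂ)⁻¹ * ((expNegInvGlue (1 - (t / ε) ^ 2) : ℝ) : ℂ))
              (1 / 2 + t * I)‖ ^ 2 *
            ‖∑ m ∈ Finset.Icc 1 M, a m * cexp (t * I * (Real.log (m : ℝ) : ℂ))‖ ^ 2 *
            (Complex.digamma (1 / 4 + t / 2 * I)).re) ↔
    0 ≤ (weilQuadratic (fun x : ℝ => ∑ m ∈ Finset.Icc 1 M,
        a m * ((ε : ℂ)⁻¹ * ((expNegInvGlue (1 - ((x - Real.log (m : ℝ)) / ε) ^ 2) : ℝ) : ℂ)))).re) := by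
  intro ε hε M a hM hw
  rw [weilQuadratic_comb_re_normalForm ε hε M a hM hw]
  constructor
  · intro h
    linarith
  · intro h
    linarith

/-- **Cells from support rungs.** For `0 < ε`, `1 ≤ M`, `2ε(M+1) ≤ 1`: Weil positivity on
`[−(log M/2 + ε), log M/2 + ε]` gives the cell (NF) at `(ε, M, a)` for every `a` — the comb is a Weil test supported in
`[−ε, log M + ε]`, `Q` is translation invariant (`weilQuadratic_translate`), and NF is `0 ≤ Re Q(g)`
(`windowCore_cell_iff`). Hence the finite range `M ≤ M₀` of the band is the rung `WeilPositivityOn (log M₀/2 + 1/(2(M₀+1)))`.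
[folklore] -/
theorem windowCore_cell_of_weilPositivityOn : ∀ ε : ℝ, 0 < ε → ∀ (M : ℕ) (a : ℕ → ℂ), 1 ≤ M →
    2 * ε * ((M : ℝ) + 1) ≤ 1 → WeilPositivityOn (Real.log M / 2 + ε) →
    ε⁻¹ * weilNorm2Sq (fun u : ℝ => ((expNegInvGlue (1 - u ^ 2) : ℝ) : ℂ)) *
        (2 * (∑ m ∈ Finset.Icc 1 M, ∑ n ∈ Finset.Icc 1 (M / m),
            ((ArithmeticFunction.vonMangoldt n : ℝ) : ℂ) / (Real.sqrt n : ℂ) * a (n * m) *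
              conj (a m)).re
          + Real.log Real.pi * ∑ m ∈ Finset.Icc 1 M, ‖a m‖ ^ 2) ≤
      2 * (weilMellin (fun t : ℝ => (ε : ℂ)⁻¹ * ((expNegInvGlue (1 - (t / ε) ^ 2) : ℝ) : ℂ)) 0 *
            conj (weilMellin (fun t : ℝ => (ε : ℂ)⁻¹ * ((expNegInvGlue (1 - (t / ε) ^ 2) : ℝ) : ℂ)) 1) *
          ((∑ m ∈ Finset.Icc 1 M, a m * ((Real.sqrt (m : ℝ) : ℝ) : ℂ)⁻¹) *
            conj (∑ m ∈ Finset.Icc 1 M, a m * ((Real.sqrt (m : ℝ) : ℝ) : ℂ)))).re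
      + 1 / (2 * Real.pi) * ∫ t : ℝ,
          ‖weilMellin (fun t : ℝ => (ε : ℂ)⁻¹ * ((expNegInvGlue (1 - (t / ε) ^ 2) : ℝ) : ℂ))
              (1 / 2 + t * I)‖ ^ 2 *
            ‖∑ m ∈ Finset.Icc 1 M, a m * cexp (t * I * (Real.log (m : ℝ) : ℂ))‖ ^ 2 *
            (Complex.digamma (1 / 4 + t / 2 * I)).re := by
  intro ε hε M a hM hw hPos
  rw [windowCore_cell_iff ε hε M a hM hw]
  set g : ℝ → ℂ := fun x : ℝ => ∑ m ∈ Finset.Icc 1 M,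
      a m * ((ε : ℂ)⁻¹ * ((expNegInvGlue (1 - ((x - Real.log (m : ℝ)) / ε) ^ 2) : ℝ) : ℂ)) with hg
  have hgW : IsWeilTest g :=
    Summit.RiemannHypothesis.RiemannHypothesis.Theorems.weilComb_shapeComb_isWeilTest ε M a
  have hsupp : tsupport g ⊆ Set.Icc (-|ε|) (Real.log M + |ε|) :=
    Summit.RiemannHypothesis.RiemannHypothesis.Theorems.weilComb_shapeComb_tsupport_subset ε M a
  -- centre the comb: `G = g(· + log M / 2)` is supported in `[−(log M/2 + ε), log M/2 + ε]`
  have hGW : IsWeilTest fun t => g (t + Real.log M / 2) := isWeilTest_translate hgW _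
  have hGsupp : tsupport (fun t => g (t + Real.log M / 2)) ⊆
      Set.Icc (-(Real.log M / 2 + ε)) (Real.log M / 2 + ε) := by
    refine (tsupport_translate_subset hsupp (Real.log M / 2)).trans ?_
    rw [abs_of_pos hε]
    refine Set.Icc_subset_Icc (le_of_eq ?_) (le_of_eq ?_) <;> ring
  have h := hPos _ hGW hGsupp
  rwa [weilQuadratic_translate] at h

/-- **The `M = 1` cells of Theorem B hold unconditionally.** For `0 < ε ≤ (log 2)/2` (in particular on the band, where
`2ε(1+1) ≤ 1` gives `ε ≤ 1/4 < 0.3465 < (log 2)/2`) and every `a`, the cell (NF) at `(ε, 1, a)` holds: it is Weil positivity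
of the single bump `a₁ φ_ε`, supported in `[−ε, ε]`, i.e. Yoshida's archimedean rung `weilPositivityOn_of_le_log_two_half`
(kernel-certified in the tree). [cite: Yoshida1992, Thm. 1 (p. 310)] -/
theorem windowCore_cells_one : ∀ ε : ℝ, 0 < ε → ∀ a : ℕ → ℂ, 2 * ε * (((1 : ℕ) : ℝ) + 1) ≤ 1 →
    ε⁻¹ * weilNorm2Sq (fun u : ℝ => ((expNegInvGlue (1 - u ^ 2) : ℝ) : ℂ)) *
        (2 * (∑ m ∈ Finset.Icc 1 1, ∑ n ∈ Finset.Icc 1 (1 / m),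
            ((ArithmeticFunction.vonMangoldt n : ℝ) : ℂ) / (Real.sqrt n : ℂ) * a (n * m) *
              conj (a m)).re
          + Real.log Real.pi * ∑ m ∈ Finset.Icc 1 1, ‖a m‖ ^ 2) ≤
      2 * (weilMellin (fun t : ℝ => (ε : ℂ)⁻¹ * ((expNegInvGlue (1 - (t / ε) ^ 2) : ℝ) : ℂ)) 0 *
            conj (weilMellin (fun t : ℝ => (ε : ℂ)⁻¹ * ((expNegInvGlue (1 - (t / ε) ^ 2) : ℝ) : ℂ)) 1) *
          ((∑ m ∈ Finset.Icc 1 1, a m * ((Real.sqrt (m : ℝ) : ℝ) : ℂ)⁻¹) *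
            conj (∑ m ∈ Finset.Icc 1 1, a m * ((Real.sqrt (m : ℝ) : ℝ) : ℂ)))).re
      + 1 / (2 * Real.pi) * ∫ t : ℝ,
          ‖weilMellin (fun t : ℝ => (ε : ℂ)⁻¹ * ((expNegInvGlue (1 - (t / ε) ^ 2) : ℝ) : ℂ))
              (1 / 2 + t * I)‖ ^ 2 *
            ‖∑ m ∈ Finset.Icc 1 1, a m * cexp (t * I * (Real.log (m : ℝ) : ℂ))‖ ^ 2 *
            (Complex.digamma (1 / 4 + t / 2 * I)).re := by
  intro ε hε a hw
  refine windowCore_cell_of_weilPositivityOn ε hε 1 a le_rfl hw (weilPositivityOn_of_le_log_two_half ?_)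
  have h2 : (0.6931471803 : ℝ) < Real.log 2 := Real.log_two_gt_d9
  push_cast at hw
  simp only [Nat.cast_one, Real.log_one, zero_div, zero_add]
  linarith

/-- **Calibration: `stub_windowCore` under RH (verbatim signature).** The band statement is RH-implied: each comb is a
Weil test and RH gives Weil positivity (`WeilPositivity.of_riemannHypothesis explicit_formula_holds`), which is the
cell by `windowCore_cell_iff`. [cite: Bombieri2000, §3 Thm 1 eq. (3.2)] -/
theorem stub_windowCore_of_riemannHypothesis : RiemannHypothesis →
    ∀ ε : ℝ, 0 < ε → ∀ (M : ℕ) (a : ℕ → ℂ), 1 ≤ M → 1 / 40 < ε * M →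
    2 * ε * ((M : ℝ) + 1) ≤ 1 →
    ε⁻¹ * weilNorm2Sq (fun u : ℝ => ((expNegInvGlue (1 - u ^ 2) : ℝ) : ℂ)) *
        (2 * (∑ m ∈ Finset.Icc 1 M, ∑ n ∈ Finset.Icc 1 (M / m),
            ((ArithmeticFunction.vonMangoldt n : ℝ) : ℂ) / (Real.sqrt n : ℂ) * a (n * m) *
              conj (a m)).re
          + Real.log Real.pi * ∑ m ∈ Finset.Icc 1 M, ‖a m‖ ^ 2) ≤
      2 * (weilMellin (fun t : ℝ => (ε : ℂ)⁻¹ * ((expNegInvGlue (1 - (t / ε) ^ 2) : ℝ) : ℂ)) 0 *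
            conj (weilMellin (fun t : ℝ => (ε : ℂ)⁻¹ * ((expNegInvGlue (1 - (t / ε) ^ 2) : ℝ) : ℂ)) 1) *
          ((∑ m ∈ Finset.Icc 1 M, a m * ((Real.sqrt (m : ℝ) : ℝ) : ℂ)⁻¹) *
            conj (∑ m ∈ Finset.Icc 1 M, a m * ((Real.sqrt (m : ℝ) : ℝ) : ℂ)))).re
      + 1 / (2 * Real.pi) * ∫ t : ℝ,
          ‖weilMellin (fun t : ℝ => (ε : ℂ)⁻¹ * ((expNegInvGlue (1 - (t / ε) ^ 2) : ℝ) : ℂ))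
              (1 / 2 + t * I)‖ ^ 2 *
            ‖∑ m ∈ Finset.Icc 1 M, a m * cexp (t * I * (Real.log (m : ℝ) : ℂ))‖ ^ 2 *
            (Complex.digamma (1 / 4 + t / 2 * I)).re := by
  intro hRH ε hε M a hM _hband hw
  rw [windowCore_cell_iff ε hε M a hM hw]
  exact WeilPositivity.of_riemannHypothesis explicit_formula_holds hRH _
    (Summit.RiemannHypothesis.RiemannHypothesis.Theorems.weilComb_shapeComb_isWeilTest ε M a)

end Summit.RiemannHypothesis.RiemannHypothesis.Theorems.WeilCombBohrFejer

end
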